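import Mathlib
import HarnessLib

/-!
# [OURS · L1 W4.5(b)] The witness ring `A = O[y^{q ≥ 0}, ϖ y⁻¹] ⊆ O[y^ℚ]` for the negative companion of
# `EquisingularLift.SpecialFibreReduciblePersists` (definitions + algebra only; no schemes)
#
# Custody res-plan-2 2026-08-27T05:33:15Z «(1⁻) NEGATIVE side := res-type-100».

Cell res-hironaka (LADDER-RESOLUTION rung L, D-0089), slot W4.5(b), crux EL♮ (stmt-ResolutionOfSingularities-20038);
`--supports … --as helper`. Prover res-type-100 (gen 9), FINDING 2026-08-27T05:32:49Z on res-L1-type-o1's typed Prop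
`EquisingularLift.SpecialFibreReduciblePersists` (p499585 §4). Everything here is OURS and elementary commutative algebra;
nothing is a statement of H. Hironaka's manuscript and no `Literature.…` fact is used.

THE RING. For a commutative ring `O` and an ideal `𝔪` let `O[y^ℚ] = AddMonoidAlgebra O ℚ` and
`A := {f ∈ O[y^ℚ] : coeff_{y^r} f ∈ 𝔪^⌈-r⌉₊ for every r ∈ ℚ}` (`ringA`, an `O`-subalgebra; for a DVR `(O, (ϖ))` this is
`O[y^q (q ≥ 0), ϖ y⁻¹]`, an integral domain which is NOT Noetherian). Contents:
* `IsWeighted 𝔪 k f` — the weight filtration `coeff_{y^r} f ∈ 𝔪^(⌈-r⌉₊ + k)`, multiplicative (`IsWeighted.mul`);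
* `yPow q` (`y^q ∈ A`, `q ≥ 0`), `xElt c` (`c y⁻¹ ∈ A`, `c ∈ 𝔪`), `xElt c * yPow 1 = c` (`xElt_mul_yPow_one`);
* `idealI = (y^q : q > 0)` is IDEMPOTENT (`isIdempotentElem_idealI`, as `y^q = y^{q/2} y^{q/2}`) and, for a prime `Q`,
  `I ≤ Q ↔ y ∈ Q` (`idealI_le_iff`);
* `primeP = ker (A → (O/𝔪)[y^ℚ])` (`redHom`), prime for `𝔪` prime; `𝔪A ≤ P₁` (`map_le_primeP`), `y ∉ P₁`;
* `𝔪A = {weight ≥ 1}` (`isWeighted_one_of_mem_map`, `exists_mem_map_coe_eq_of_isWeighted_one`), whence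
  `y · P₁ ⊆ 𝔪A` (`yPow_one_mul_mem_map_of_mem_primeP`);
* over a DVR `(O, 𝔪 = (ϖ))`: `(ϖ y⁻¹)^n ∉ 𝔪A`, `y^n ∉ 𝔪A`, `(ϖ y⁻¹)·y ∈ 𝔪A` — so the special fibre `V(𝔪A)` of
  `Spec A → Spec O` is `V(ϖ y⁻¹) ∪ V(y)`, reducible, while `V(𝔪A) ∩ D(y)` is irreducible with generic point `P₁`.
The scheme-level use (the blow-up of `Spec A` along the idempotent `Ĩ` is the open immersion `D(y) ↪ Spec A`, whose
special fibre is irreducible although that of `Spec A` is not) is in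
`…EquisingularLiftCampaignW45bULTSpecialFibrePersistsCounterexample.lean`. AI-written; AI review is weaker than expert review.
[Hironaka2017] — scope only.
-/

noncomputable section

set_option linter.dupNamespace false -- mandated namespace of this single-conjunct summit

open AddMonoidAlgebra

namespace Summit.ResolutionOfSingularities.ResolutionOfSingularities.Theorems

namespace EquisingularLift

namespace SpecialFibreWitness


variable {O : Type*} [CommRing O] (𝔪 : Ideal O)

/-- [OURS] Weight condition of level `k` on `f ∈ O[y^ℚ]`: the coefficient of `y^r` lies in `𝔪 ^ (⌈-r⌉₊ + k)` for every
`r ∈ ℚ` (a predicate with parameters, not a named fact). [folklore] -/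
def IsWeighted (k : ℕ) (f : AddMonoidAlgebra O ℚ) : Prop :=
  ∀ r : ℚ, f.coeff r ∈ 𝔪 ^ (⌈-r⌉₊ + k)

variable {𝔪}

/-- `0` has every weight. [folklore] -/
theorem isWeighted_zero (k : ℕ) : IsWeighted 𝔪 k 0 := fun r => by simp

/-- Weights are additive subgroups: closed under `+`. [folklore] -/
theorem IsWeighted.add {k : ℕ} {f g : AddMonoidAlgebra O ℚ} (hf : IsWeighted 𝔪 k f) (hg : IsWeighted 𝔪 k g) :
    IsWeighted 𝔪 k (f + g) := fun r => by
  rw [coeff_add, Finsupp.add_apply]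
  exact add_mem (hf r) (hg r)

/-- Weights are closed under negation. [folklore] -/
theorem IsWeighted.neg {k : ℕ} {f : AddMonoidAlgebra O ℚ} (hf : IsWeighted 𝔪 k f) : IsWeighted 𝔪 k (-f) := fun r => by
  rw [coeff_neg, Finsupp.neg_apply]
  exact neg_mem (hf r)

/-- A larger weight level implies a smaller one (`𝔪^{a+k} ⊆ 𝔪^{a+j}` for `j ≤ k`). [folklore] -/
theorem IsWeighted.mono {j k : ℕ} (hjk : j ≤ k) {f : AddMonoidAlgebra O ℚ} (hf : IsWeighted 𝔪 k f) :
    IsWeighted 𝔪 j f := fun r => Ideal.pow_le_pow_right (by omega) (hf r)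

/-- Weights add under multiplication: the `y^r`-coefficient of `f g` is `Σ_{s+t=r} f_s g_t` and
`⌈-r⌉₊ ≤ ⌈-s⌉₊ + ⌈-t⌉₊`. [folklore] -/
theorem IsWeighted.mul {j k : ℕ} {f g : AddMonoidAlgebra O ℚ} (hf : IsWeighted 𝔪 j f) (hg : IsWeighted 𝔪 k g) :
    IsWeighted 𝔪 (j + k) (f * g) := by
  intro r
  classical
  rw [coeff_mul]
  unfold Finsupp.sum
  refine Ideal.sum_mem _ fun s _ => Ideal.sum_mem _ fun t _ => ?_
  dsimp only
  split_ifs with hst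
  · subst hst
    have h := Ideal.mul_mem_mul (hf s) (hg t)
    rw [← pow_add] at h
    refine Ideal.pow_le_pow_right ?_ h
    have := Nat.ceil_add_le (-s) (-t)
    rw [neg_add]
    omega
  · exact zero_mem _

/-- A monomial `c y^r` has weight `k` as soon as `c ∈ 𝔪^(⌈-r⌉₊ + k)`. [folklore] -/
theorem isWeighted_single {k : ℕ} {r : ℚ} {c : O} (hc : c ∈ 𝔪 ^ (⌈-r⌉₊ + k)) :
    IsWeighted 𝔪 k (single r c) := by
  intro r'
  classical
  rw [coeff_single, Finsupp.single_apply]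
  split_ifs with h
  · subst h; exact hc
  · exact zero_mem _

variable (𝔪)

/-- [OURS] The ring `A := {f ∈ O[y^ℚ] : coeff_r f ∈ 𝔪^⌈-r⌉₊ for all r}` as an `O`-subalgebra of `O[y^ℚ]` (for a DVR
`(O, (ϖ))`: `A = O[y^q (q ≥ 0), ϖ y⁻¹]`). [folklore] -/
def ringA : Subalgebra O (AddMonoidAlgebra O ℚ) where
  carrier := {f | IsWeighted 𝔪 0 f}
  mul_mem' {a b} ha hb := by simpa using ha.mul hb
  add_mem' {a b} ha hb := ha.add hb
  algebraMap_mem' c := by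
    change IsWeighted 𝔪 0 (algebraMap O (AddMonoidAlgebra O ℚ) c)
    rw [AddMonoidAlgebra.coe_algebraMap, Function.comp_apply, Algebra.algebraMap_self, RingHom.id_apply]
    exact isWeighted_single (by simp)

/-- Membership in `A` (unfolding). [folklore] -/
theorem mem_ringA_iff {f : AddMonoidAlgebra O ℚ} : f ∈ ringA 𝔪 ↔ IsWeighted 𝔪 0 f := Iff.rfl

/-- [OURS] The element `y^q ∈ A` for `q ≥ 0`. [folklore] -/
def yPow (q : ℚ) (hq : 0 ≤ q) : ringA 𝔪 :=
  ⟨single q 1, isWeighted_single (by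
    rw [Nat.ceil_eq_zero.mpr (by linarith), zero_add, pow_zero, Ideal.one_eq_top]; exact Submodule.mem_top)⟩

/-- `y^q` as an element of `O[y^ℚ]` (unfolding). [folklore] -/
@[simp] theorem coe_yPow (q : ℚ) (hq : 0 ≤ q) : (yPow 𝔪 q hq : AddMonoidAlgebra O ℚ) = single q 1 := rfl

/-- `y^p · y^q = y^{p+q}`. [folklore] -/
theorem yPow_mul (p q : ℚ) (hp : 0 ≤ p) (hq : 0 ≤ q) :
    yPow 𝔪 p hp * yPow 𝔪 q hq = yPow 𝔪 (p + q) (by positivity) := by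
  apply Subtype.ext
  change single p (1 : O) * single q 1 = single (p + q) 1
  rw [single_mul_single, mul_one]

/-- `(y^q)^N = y^{Nq}`. [folklore] -/
theorem yPow_pow (q : ℚ) (hq : 0 ≤ q) (N : ℕ) :
    yPow 𝔪 q hq ^ N = yPow 𝔪 (N * q) (by positivity) := by
  apply Subtype.ext
  change (single q (1 : O)) ^ N = single ((N : ℚ) * q) 1
  rw [single_pow, one_pow, nsmul_eq_mul]

/-- [OURS] The element `c · y⁻¹ ∈ A` for `c ∈ 𝔪`. [folklore] -/
def xElt (c : O) (hc : c ∈ 𝔪) : ringA 𝔪 :=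
  ⟨single (-1) c, isWeighted_single (by rw [neg_neg, Nat.ceil_one, add_zero, pow_one]; exact hc)⟩

/-- `c y⁻¹` as an element of `O[y^ℚ]` (unfolding). [folklore] -/
@[simp] theorem coe_xElt (c : O) (hc : c ∈ 𝔪) : (xElt 𝔪 c hc : AddMonoidAlgebra O ℚ) = single (-1) c := rfl

/-- The structure map `O → A` is `c ↦ c y^0`. [folklore] -/
theorem coe_algebraMap_ringA (c : O) :
    ((algebraMap O (ringA 𝔪) c : ringA 𝔪) : AddMonoidAlgebra O ℚ) = single 0 c := by
  change algebraMap O (AddMonoidAlgebra O ℚ) c = single 0 c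
  rw [AddMonoidAlgebra.coe_algebraMap, Function.comp_apply, Algebra.algebraMap_self, RingHom.id_apply]

/-- `(c·y⁻¹) · y = c` in `A`. [folklore] -/
theorem xElt_mul_yPow_one (c : O) (hc : c ∈ 𝔪) :
    xElt 𝔪 c hc * yPow 𝔪 1 zero_le_one = algebraMap O (ringA 𝔪) c := by
  apply Subtype.ext
  rw [coe_algebraMap_ringA]
  change single (-1) c * single 1 (1 : O) = single 0 c
  rw [single_mul_single, mul_one, neg_add_cancel]

/-- [OURS] The ideal `I = (y^q : q > 0)` of `A` (idempotent, `isIdempotentElem_idealI`). [folklore] -/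
def idealI : Ideal (ringA 𝔪) :=
  Ideal.span (Set.range fun q : {q : ℚ // 0 < q} => yPow 𝔪 q.1 q.2.le)

/-- The generators `y^q` (`q > 0`) lie in `I`. [folklore] -/
theorem yPow_mem_idealI (q : ℚ) (hq : 0 < q) : yPow 𝔪 q hq.le ∈ idealI 𝔪 :=
  Ideal.subset_span ⟨⟨q, hq⟩, rfl⟩

/-- `I² = I`: each generator `y^q = y^{q/2} · y^{q/2}` is a product of two generators. [folklore] -/
theorem isIdempotentElem_idealI : IsIdempotentElem (idealI 𝔪) := by
  apply le_antisymm Ideal.mul_le_right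
  conv_lhs => rw [idealI]
  rw [Ideal.span_le]
  rintro _ ⟨⟨q, hq⟩, rfl⟩
  have h : yPow 𝔪 q hq.le = yPow 𝔪 (q / 2) (by positivity) * yPow 𝔪 (q / 2) (by positivity) := by
    rw [yPow_mul]; congr 1; ring
  show yPow 𝔪 q hq.le ∈ idealI 𝔪 * idealI 𝔪
  rw [h]
  exact Ideal.mul_mem_mul (yPow_mem_idealI 𝔪 _ (by positivity)) (yPow_mem_idealI 𝔪 _ (by positivity))

/-- For a prime `Q` of `A`: `I ≤ Q ↔ y ∈ Q` (`(y^q)^N = y · y^{Nq-1}` for `Nq ≥ 1`). [folklore] -/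
theorem idealI_le_iff {Q : Ideal (ringA 𝔪)} (hQ : Q.IsPrime) :
    idealI 𝔪 ≤ Q ↔ yPow 𝔪 1 zero_le_one ∈ Q := by
  constructor
  · intro h; exact h (yPow_mem_idealI 𝔪 1 one_pos)
  · intro hy
    rw [idealI, Ideal.span_le]
    rintro _ ⟨⟨q, hq⟩, rfl⟩
    obtain ⟨N, hN⟩ := exists_nat_ge (1 / q)
    have hNq : 1 ≤ (N : ℚ) * q := by
      rw [div_le_iff₀ hq] at hN; exact hN
    apply hQ.mem_of_pow_mem N
    rw [yPow_pow]
    have h : yPow 𝔪 ((N : ℚ) * q) (by positivity) =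
        yPow 𝔪 1 zero_le_one * yPow 𝔪 ((N : ℚ) * q - 1) (by linarith) := by
      rw [yPow_mul]; congr 1; ring
    rw [h]
    exact Q.mul_mem_right _ hy

/-- [OURS] Reduction of coefficients mod `𝔪`, restricted to `A`: `A → (O/𝔪)[y^ℚ]`. [folklore] -/
def redHom : ringA 𝔪 →+* AddMonoidAlgebra (O ⧸ 𝔪) ℚ :=
  (AddMonoidAlgebra.mapRingHom ℚ (Ideal.Quotient.mk 𝔪)).comp (ringA 𝔪).val.toRingHom

/-- Coefficients of the reduction (unfolding). [folklore] -/
theorem redHom_apply_coeff (f : ringA 𝔪) (r : ℚ) :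
    (redHom 𝔪 f).coeff r = Ideal.Quotient.mk 𝔪 ((f : AddMonoidAlgebra O ℚ).coeff r) := by
  simp [redHom]

/-- [OURS] The ideal `P₁ = ker (A → (O/𝔪)[y^ℚ])` (for a DVR: the generic point of the component `V(ϖ y⁻¹)` of the
special fibre of `Spec A`). [folklore] -/
def primeP : Ideal (ringA 𝔪) := RingHom.ker (redHom 𝔪)

/-- `f ∈ P₁` iff every coefficient of `f` lies in `𝔪`. [folklore] -/
theorem mem_primeP_iff (f : ringA 𝔪) : f ∈ primeP 𝔪 ↔ ∀ r, (f : AddMonoidAlgebra O ℚ).coeff r ∈ 𝔪 := by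
  rw [primeP, RingHom.mem_ker]
  constructor
  · intro h r
    rw [← Ideal.Quotient.eq_zero_iff_mem, ← redHom_apply_coeff, h]; rfl
  · intro h
    refine AddMonoidAlgebra.ext (Finsupp.ext fun r => ?_)
    rw [redHom_apply_coeff, Ideal.Quotient.eq_zero_iff_mem.mpr (h r), coeff_zero, Finsupp.zero_apply]

/-- `P₁` is prime when `𝔪` is (the target `(O/𝔪)[y^ℚ]` is a domain). [folklore] -/
theorem isPrime_primeP [𝔪.IsPrime] : (primeP 𝔪).IsPrime := by
  haveI : IsDomain (O ⧸ 𝔪) := Ideal.Quotient.isDomain 𝔪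
  exact RingHom.ker_isPrime _

/-- `𝔪A ≤ P₁`. [folklore] -/
theorem map_le_primeP : 𝔪.map (algebraMap O (ringA 𝔪)) ≤ primeP 𝔪 := by
  rw [Ideal.map_le_iff_le_comap]
  intro c hc
  rw [Ideal.mem_comap, mem_primeP_iff]
  intro r
  rw [coe_algebraMap_ringA, coeff_single]
  classical
  rw [Finsupp.single_apply]
  split_ifs
  · exact hc
  · exact zero_mem _

/-- `y ∉ P₁` (if `𝔪 ≠ ⊤`). [folklore] -/
theorem yPow_one_notMem_primeP (h𝔪 : 𝔪 ≠ ⊤) : yPow 𝔪 1 zero_le_one ∉ primeP 𝔪 := by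
  rw [mem_primeP_iff]
  intro h
  have := h 1
  rw [coe_yPow, coeff_single, Finsupp.single_eq_same] at this
  exact h𝔪 ((Ideal.eq_top_iff_one _).mpr this)

/-- Elements of `𝔪A` have weight `1`. [folklore] -/
theorem isWeighted_one_of_mem_map {f : ringA 𝔪} (hf : f ∈ 𝔪.map (algebraMap O (ringA 𝔪))) :
    IsWeighted 𝔪 1 (f : AddMonoidAlgebra O ℚ) := by
  rw [Ideal.map, ← Ideal.submodule_span_eq] at hf
  refine Submodule.span_induction ?_ ?_ ?_ ?_ hf
  · rintro _ ⟨c, hc, rfl⟩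
    rw [coe_algebraMap_ringA]
    exact isWeighted_single (by simpa using hc)
  · exact isWeighted_zero 1
  · intro a b _ _ ha hb
    exact ha.add hb
  · intro a b _ hb
    rw [smul_eq_mul, Subalgebra.coe_mul]
    simpa using (a.2 : IsWeighted 𝔪 0 (a : AddMonoidAlgebra O ℚ)).mul hb

/-- Conversely, an element of `O[y^ℚ]` of weight `1` lies in `𝔪A` (decompose into monomials `c y^r` with
`c ∈ 𝔪 · 𝔪^⌈-r⌉₊`). [folklore] -/
theorem exists_mem_map_coe_eq_of_isWeighted_one {g : AddMonoidAlgebra O ℚ} (hg : IsWeighted 𝔪 1 g) :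
    ∃ a ∈ 𝔪.map (algebraMap O (ringA 𝔪)), (a : AddMonoidAlgebra O ℚ) = g := by
  classical
  -- single pieces
  have hsingle : ∀ (r : ℚ) (d : O), d ∈ 𝔪 ^ (⌈-r⌉₊ + 1) →
      ∃ a ∈ 𝔪.map (algebraMap O (ringA 𝔪)), (a : AddMonoidAlgebra O ℚ) = single r d := by
    intro r d hd
    rw [pow_succ'] at hd
    refine Submodule.mul_induction_on hd ?_ ?_
    · intro m hm c hc
      refine ⟨algebraMap O (ringA 𝔪) m * ⟨single r c, isWeighted_single (by simpa using hc)⟩,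
        Ideal.mul_mem_right _ _ (Ideal.mem_map_of_mem _ hm), ?_⟩
      rw [Subalgebra.coe_mul, coe_algebraMap_ringA]
      change single 0 m * single r c = single r (m * c)
      rw [single_mul_single, zero_add]
    · rintro x y ⟨a, ha, hax⟩ ⟨b, hb, hby⟩
      exact ⟨a + b, add_mem ha hb, by rw [Subalgebra.coe_add, hax, hby, single_add]⟩
  -- induction on the support
  suffices h : ∀ (φ : ℚ →₀ O), (∀ r, φ r ∈ 𝔪 ^ (⌈-r⌉₊ + 1)) →
      ∃ a ∈ 𝔪.map (algebraMap O (ringA 𝔪)), (a : AddMonoidAlgebra O ℚ) = AddMonoidAlgebra.ofCoeff φ by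
    obtain ⟨a, ha, hag⟩ := h g.coeff (fun r => hg r)
    exact ⟨a, ha, by rw [hag, AddMonoidAlgebra.ofCoeff_coeff]⟩
  intro φ
  induction φ using Finsupp.induction with
  | zero => intro _; exact ⟨0, zero_mem _, by simp⟩
  | single_add r d φ hr hd ih =>
    intro hφ
    have hφ' : ∀ r', φ r' ∈ 𝔪 ^ (⌈-r'⌉₊ + 1) := by
      intro r'
      by_cases h : r' = r
      · subst h
        rw [Finsupp.notMem_support_iff.mp hr]; exact zero_mem _
      · have := hφ r'
        rwa [Finsupp.add_apply, Finsupp.single_apply, if_neg (Ne.symm h), zero_add] at this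
    have hdr : d ∈ 𝔪 ^ (⌈-r⌉₊ + 1) := by
      have := hφ r
      rwa [Finsupp.add_apply, Finsupp.single_eq_same, Finsupp.notMem_support_iff.mp hr, add_zero] at this
    obtain ⟨a, ha, haφ⟩ := ih hφ'
    obtain ⟨b, hb, hbd⟩ := hsingle r d hdr
    refine ⟨b + a, add_mem hb ha, ?_⟩
    rw [Subalgebra.coe_add, haφ, hbd, AddMonoidAlgebra.ofCoeff_add, AddMonoidAlgebra.ofCoeff_single]

/-- For `f ∈ P₁`: `y · f ∈ 𝔪A` (the coefficients of `y f` have weight `1`). [folklore] -/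
theorem yPow_one_mul_mem_map_of_mem_primeP {f : ringA 𝔪} (hf : f ∈ primeP 𝔪) :
    yPow 𝔪 1 zero_le_one * f ∈ 𝔪.map (algebraMap O (ringA 𝔪)) := by
  have hw : IsWeighted 𝔪 1 ((yPow 𝔪 1 zero_le_one * f : ringA 𝔪) : AddMonoidAlgebra O ℚ) := by
    intro r'
    rw [Subalgebra.coe_mul, coe_yPow, AddMonoidAlgebra.coeff_single_mul_apply, one_mul]
    -- coefficient of `f` at `r := -1 + r'`
    have h0 : (f : AddMonoidAlgebra O ℚ).coeff (-1 + r') ∈ 𝔪 ^ ⌈-(-1 + r')⌉₊ := by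
      simpa using (f.2 : IsWeighted 𝔪 0 (f : AddMonoidAlgebra O ℚ)) (-1 + r')
    have h1 : (f : AddMonoidAlgebra O ℚ).coeff (-1 + r') ∈ 𝔪 := (mem_primeP_iff 𝔪 f).mp hf _
    rcases le_or_gt (-r') 0 with hr | hr
    · rw [Nat.ceil_eq_zero.mpr hr, zero_add, pow_one]; exact h1
    · have e : ⌈-(-1 + r')⌉₊ = ⌈-r'⌉₊ + 1 := by
        rw [show -(-1 + r') = (-r' : ℚ) + 1 by ring]
        exact Nat.ceil_add_one hr.le
      rw [← e]; exact h0
  obtain ⟨a, ha, hae⟩ := exists_mem_map_coe_eq_of_isWeighted_one 𝔪 hw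
  rwa [Subtype.ext hae] at ha

/-! ### Over a discrete valuation ring `(O, 𝔪 = (ϖ))` -/

section DVR

variable {O : Type*} [CommRing O] [IsDomain O] [IsDiscreteValuationRing O]

/-- Over a DVR `(O, (ϖ))`: `(ϖ y⁻¹)^n ∉ 𝔪A` — its `y^{-n}`-coefficient `ϖ^n` is not in `𝔪^{n+1}`. [folklore] -/
theorem xElt_pow_notMem_map {ϖ : O} (hϖ : Irreducible ϖ) (n : ℕ) :
    xElt (IsLocalRing.maximalIdeal O) ϖ (hϖ.maximalIdeal_eq ▸ Ideal.mem_span_singleton_self ϖ) ^ n ∉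
      (IsLocalRing.maximalIdeal O).map (algebraMap O (ringA (IsLocalRing.maximalIdeal O))) := by
  intro hmem
  have hw := isWeighted_one_of_mem_map _ hmem (-(n : ℚ))
  rw [Subalgebra.coe_pow, coe_xElt, single_pow, neg_neg, Nat.ceil_natCast,
    show n • (-1 : ℚ) = -(n : ℚ) by rw [nsmul_eq_mul, mul_neg_one], coeff_single, Finsupp.single_eq_same,
    hϖ.maximalIdeal_eq, Ideal.span_singleton_pow, Ideal.mem_span_singleton,
    pow_dvd_pow_iff hϖ.ne_zero hϖ.not_isUnit] at hw
  omega

/-- Over a DVR: `y^n ∉ 𝔪A` — its `y^n`-coefficient is `1 ∉ 𝔪`. [folklore] -/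
theorem yPow_one_pow_notMem_map (n : ℕ) :
    yPow (IsLocalRing.maximalIdeal O) 1 zero_le_one ^ n ∉
      (IsLocalRing.maximalIdeal O).map (algebraMap O (ringA (IsLocalRing.maximalIdeal O))) := by
  intro hmem
  have hw := isWeighted_one_of_mem_map _ hmem (n : ℚ)
  rw [Subalgebra.coe_pow, coe_yPow, single_pow, one_pow, nsmul_eq_mul, mul_one, coeff_single,
    Finsupp.single_eq_same, Nat.ceil_eq_zero.mpr (by simp), zero_add, pow_one] at hw
  exact (IsLocalRing.maximalIdeal.isMaximal O).ne_top ((Ideal.eq_top_iff_one _).mpr hw)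

/-- Over a DVR `(O, (ϖ))`: `(ϖ y⁻¹) · y = ϖ ∈ 𝔪A`. [folklore] -/
theorem xElt_mul_yPow_one_mem_map {ϖ : O} (hϖ : Irreducible ϖ) :
    xElt (IsLocalRing.maximalIdeal O) ϖ (hϖ.maximalIdeal_eq ▸ Ideal.mem_span_singleton_self ϖ) *
        yPow (IsLocalRing.maximalIdeal O) 1 zero_le_one ∈
      (IsLocalRing.maximalIdeal O).map (algebraMap O (ringA (IsLocalRing.maximalIdeal O))) := by
  rw [xElt_mul_yPow_one]
  exact Ideal.mem_map_of_mem _ (hϖ.maximalIdeal_eq ▸ Ideal.mem_span_singleton_self ϖ)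

end DVR

end SpecialFibreWitness

end EquisingularLift

end Summit.ResolutionOfSingularities.ResolutionOfSingularities.Theorems

end
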